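import Summits.ResolutionOfSingularities.ResolutionOfSingularities.Theorems.FrobeniusLadderFRationalResolutionFixedPointLogRegularNhd
import HarnessLib

/-!
# Crux `FrobeniusLadder.FRationalResolution` (stmt-ResolutionOfSingularities-15317), line `redirect`,
# stub `stub_diagonalizableQuotientResolution` — log-regular neighbourhood of a fixed point for the
# monomial chart of ANY homogeneous PART of a regular system of parameters with monomial generation
# (brick W2'(b) of memo MEMO-15317-leafhand2-g4 §2bis)

`…FixedPointLogRegularNhd.exists_nhd_isLogRegularAt_of_fixed` builds its own FULL homogeneous
regular system of parameters at the fixed prime `𝔔`. For the wild non-fixed points (memo §2bis) the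
same conclusion is needed for a SUB-family: after coarsening the grading to `A/B` (so that `𝔔` becomes
fixed and the degree-zero ring is `T = S^{(B)}`), only the parameters of degree `≠ 0` in `A/B` carry
the chart, the others lie in `T`. This file re-runs the assembly with the family as INPUT:
`x : Fin n → S` homogeneous of degrees `aᵢ`, part of a regular system of parameters at `𝔔`
(`IsRsopPart`), with MONOMIAL GENERATION `g • S ⊆ S₀[x]` for some `g ∈ S₀ ∖ 𝔔` — which holds for the
sub-family of a stabilizer-adapted system (`…StabilizerAdaptedGenerators`) because the remaining
parameters lie in the base ring. Output: `g' ∈ S₀ ∖ 𝔔` with `LogChart.IsLogRegularAt P φ 𝔮'` for every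
prime `𝔮' ∌ g'` of `S₀`, `P = {m ≥ 0 : Σ mᵢaᵢ = 0}`, `φ(m) = x^m`.

* `contraction_of_hgen` — the contraction property of `…FixedPointContraction` from monomial
  generation alone (no spanning hypothesis);
* **`exists_nhd_isLogRegularAt_of_family`** — the theorem.

Honest label: brick of the wild route (no stub closed). No definitions, no named facts, no sorry.
[cite: Kato1994, Def. (2.1), Prop. (7.1)] [cite: Matsumura1987, Thms. 14.2, 23.7]
-/

noncomputable section

-- single-problem summit: the doubled namespace component is forced
set_option linter.dupNamespace false

open IsLocalRing Literature.AlgebraicGeometry.Resolution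
open Literature.AlgebraicGeometry.Resolution.DiagonalizableQuotient

namespace Summit.ResolutionOfSingularities.ResolutionOfSingularities.Theorems.FRationalResolution.FamilyLogRegularNhd

universe u w

variable {k : Type u} [Field k] {A : Type w} [DecidableEq A] [AddCommGroup A] {S : Type u}
  [CommRing S] [Algebra k S] (𝒮 : A → Submodule k S) [GradedAlgebra 𝒮]
  {n : ℕ} (x : Fin n → S) (a : Fin n → A) (hx : ∀ i, x i ∈ 𝒮 (a i))

include hx in
/-- **Contraction from monomial generation.** If `g • S ⊆ S₀[x]`, then for every `I` and every
degree-zero `r ∈ (x_I)S`, `g r` lies in the `S₀`-span of the degree-zero monomials in `x` lying in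
`(x_I)`. [folklore] -/
theorem contraction_of_hgen (g : 𝒮 0)
    (hgen : ∀ s : S, (g : S) * s ∈ Algebra.adjoin (𝒮 0) (Set.range x))
    (I : Finset (Fin n)) (r : S) (hr0 : r ∈ 𝒮 0) (hrI : r ∈ Ideal.span (x '' (↑I : Set (Fin n)))) :
    (g : S) * r ∈ Submodule.span (𝒮 0) {μ : S | μ ∈ Submonoid.closure (Set.range x) ∧ μ ∈ 𝒮 0 ∧
      μ ∈ Ideal.span (x '' (↑I : Set (Fin n)))} := by
  classical
  have hrI' : r ∈ Submodule.span S (x '' (↑I : Set (Fin n))) := hrI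
  obtain ⟨c, hc⟩ := (Fintype.mem_span_image_iff_exists_fun S).mp hrI'
  let b : Fin n → S := fun i => if h : i ∈ I then (g : S) * c ⟨i, h⟩ else 0
  have hgr0 : (g : S) * r ∈ 𝒮 0 := by
    have h := SetLike.mul_mem_graded g.2 hr0
    rwa [add_zero] at h
  refine FixedPointContraction.mem_span_monomials_of_eq_sum 𝒮 x a hx I b (fun i hi => ?_) _ hgr0 ?_
  · simp only [b, dif_pos hi]
    exact hgen _
  · rw [← hc, Finset.mul_sum, ← Finset.sum_coe_sort I]
    refine Finset.sum_congr rfl fun i _ => ?_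
    have hi : (i : Fin n) ∈ I := i.2
    simp only [b, dif_pos hi, smul_eq_mul]
    ring

include hx in
/-- **Log-regular neighbourhood for the chart of a homogeneous part of a regular system of parameters
with monomial generation.** `S` regular of finite type over a field, graded by a torsion group;
`𝔔 ⊇ S_a` (`a ≠ 0`) a prime; `x₁,…,x_n ∈ S` homogeneous of degrees `aᵢ`, part of a regular system of
parameters of `S_𝔔`, with `g • S ⊆ S₀[x]` for some `g ∈ S₀ ∖ 𝔔`. Then for the chart `φ(m) = x^m` on
`P = {m ∈ ℤⁿ_{≥0} : Σ mᵢaᵢ = 0}` there is `g' ∈ S₀ ∖ 𝔔` with `LogChart.IsLogRegularAt P φ 𝔮'` for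
every prime `𝔮' ∌ g'` of `S₀`. [cite: Kato1994, Def. (2.1), Prop. (7.1)] -/
theorem exists_nhd_isLogRegularAt_of_family [IsRegularRing S] [Algebra.FiniteType k S]
    (hA : AddMonoid.IsTorsion A) (𝔔 : Ideal S) [𝔔.IsPrime]
    (hfix : ∀ a : A, a ≠ 0 → ∀ s ∈ 𝒮 a, s ∈ 𝔔)
    (hrsop : IsRsopPart fun i => algebraMap S (Localization.AtPrime 𝔔) (x i))
    (g : 𝒮 0) (hg : (g : S) ∉ 𝔔)
    (hgen : ∀ s : S, (g : S) * s ∈ Algebra.adjoin (𝒮 0) (Set.range x))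
    (φ : Multiplicative ↥(AddSubmonoid.nonneg (Fin n → ℤ) ⊓
      AddMonoidHom.mker (Fintype.linearCombination ℤ a).toAddMonoidHom) →* 𝒮 0)
    (hφ : ∀ p, ((φ (Multiplicative.ofAdd p) : 𝒮 0) : S) = ∏ i, x i ^ ((p : Fin n → ℤ) i).toNat) :
    ∃ g' : 𝒮 0, (g' : S) ∉ 𝔔 ∧ ∀ (𝔮' : Ideal (𝒮 0)) [𝔮'.IsPrime], g' ∉ 𝔮' →
      LogChart.IsLogRegularAt _ φ 𝔮' := by
  classical
  haveI : IsNoetherianRing (𝒮 0) := isNoetherianRing_gradeZero 𝒮 hA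
  haveI : Algebra.IsIntegral (𝒮 0) S := algebra_isIntegral 𝒮 hA
  have ha : ∀ i, IsOfFinAddOrder (a i) := fun i => hA (a i)
  -- the snc neighbourhood of the rsop part, saturated to degree zero
  obtain ⟨f₁, hf₁, hnhd⟩ := RsopStrataNhd.exists_nhd_of_isRsopPart k ⟨𝔔, inferInstance⟩ x hrsop
  obtain ⟨g₁, hg₁, hsat⟩ :=
    FixedPointSaturation.exists_gradeZero_basicOpen_subset_of_fixed 𝒮 hA 𝔔 hfix f₁ hf₁
  refine ⟨g₁ * g, ?_, fun 𝔮' _ hg𝔮' => ?_⟩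
  · rw [SetLike.GradeZero.coe_mul]
    exact fun h => (‹𝔔.IsPrime›.mem_or_mem h).elim hg₁ hg
  -- a prime of `S` over `𝔮'` of the same local dimension
  obtain ⟨𝔔', h𝔔', h𝔔'𝔮, hdim⟩ := GoingUpHeight.exists_liesOver_ringKrullDim_eq
    (algebraMap_gradeZero_injective 𝒮) 𝔮'
  subst h𝔔'𝔮
  have hgg : ((g₁ * g : 𝒮 0) : S) ∉ 𝔔' := fun h => hg𝔮' (Ideal.mem_comap.mpr h)
  rw [SetLike.GradeZero.coe_mul] at hgg
  have hg₁' : (g₁ : S) ∉ 𝔔' := fun h => hgg (𝔔'.mul_mem_right _ h)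
  have hg' : (g : S) ∉ 𝔔' := fun h => hgg (𝔔'.mul_mem_left _ h)
  have hf₁' : f₁ ∉ 𝔔' := hsat 𝔔' h𝔔' hg₁'
  -- the stratum through `𝔔'`
  set I : Finset (Fin n) := Finset.univ.filter (fun i => x i ∈ 𝔔') with hIdef
  have hI : ∀ i, i ∈ I ↔ x i ∈ 𝔔' := fun i => by simp [hIdef]
  set ys : List S := (List.ofFn x).filter (fun y => decide (y ∈ 𝔔')) with hys
  have hsub : ys.Sublist (List.ofFn x) := List.filter_sublist
  have hys𝔔 : ∀ y ∈ ys, y ∈ 𝔔' := fun y hy => by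
    have h := (List.mem_filter.mp hy).2
    simpa using h
  obtain ⟨hreg, -, hdimS⟩ := hnhd ⟨𝔔', h𝔔'⟩ hf₁' ys hsub hys𝔔
  have hofList : Ideal.ofList ys = Ideal.span (x '' (↑I : Set (Fin n))) :=
    FixedPointLogRegularNhd.ofList_filter_ofFn_eq x 𝔔' I hI
  have hlen : ys.length = I.card := FixedPointLogRegularNhd.length_filter_ofFn (· ∈ 𝔔') x
  rw [hofList] at hreg hdimS
  rw [hlen] at hdimS
  -- the single-prime packaging
  exact FixedPointChartLogRegular.isLogRegularAt_chart_of_stratum 𝒮 x a hx φ hφ 𝔔' I hI hA g hg'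
    hgen (fun r hr0 hrI => contraction_of_hgen 𝒮 x a hx g hgen I r hr0 hrI) hreg hdimS hdim

end Summit.ResolutionOfSingularities.ResolutionOfSingularities.Theorems.FRationalResolution.FamilyLogRegularNhd

end
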